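import Summits.HodgeConjecture.HodgeConjecture.Theorems.F0P3XiPacketFamilyOfRecordUnram   -- ★ `ramOfRecord₂`, `good_of_not_mem_ramOfRecord₂`, (B1) `semilocalComponent_eq_one_of_forall_isUnramifiedAt`
import Literature.NumberTheory.Automorphic.LocalHermitianFormSign                         -- ★ `formSignAt`, `formSignAt_of_not_subsingleton`, `formSignAt_of_subsingleton`, `neg_det_mem_maximalRealSubfield_of_isHermitian`
import Literature.NumberTheory.Automorphic.UnitaryGroupBorelInduction                     -- ★ `IsQuadraticCharExtension` (frame hypothesis `hquad`)
import HarnessLib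

/-!
# R90-TF · S7 (Ch. 14.6-tuple, C146) · socket S7#6 `stub_R90_S7_formSignOffRam` — «`c_v = 1` off `ramOfRecord₂ ξ`» PROVED
# ([Rogawski1990, §14.6 p. 242 «c_v = 1 for almost all v»; (14.6.3) p. 243; §3.5 Prop. 3.5.2 (c) p. 29])

Cell `hodgecm-mathlib`, crux H413 (`stmt-HodgeConjecture-24833`), route of record `HCCMUnconditional`; programme R90-TF (brief
`director/R90-BRIEF.v2.md` 1f40d54518340a35), section S7 = Rogawski §14.6 (base `R90-C146`), seat R90-C146-p01 (g0), socket S7#6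
`Summit.HodgeConjecture.HodgeConjecture.R90.S7.stub_R90_S7_formSignOffRam` of `Cruxes/H413/Lines/R90_S7_PKtupleBaseChainA.lean` (ED. 1 d9c991a92cc9 ∕ ED. 2),
DEAL «EMIT S7 WAVE 1» (LH7-plan (g4), R90 bus 2026-09-04T15:32:37Z), PROOF-ROAD-S7-6 v1 (LH7-typ2 (g0)), AUDIT S7#6 CLEAN (LH7-audit1 (g0)).
Helper file, lane `--supports stmt-HodgeConjecture-24833 --as helper`; theorems only (no definition, no instance, no notation, no `sorry`).

THE STATEMENT (binders token-for-token those of the socket).  For the CM field `L` with conjugation `c`, a `c`-hermitian `H ∈ M₃(L)` with `det H` a unit,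
a Hecke character `μω` of `L` with the frame hypothesis `hquad` («at a non-split `v`, `μω_v|_{L⁺_vˣ}` is the quadratic character of `L_w ∕ L⁺_v`», i.e. a `c`-fixed
unit of `L ⊗ L⁺_v` is killed by `μω_v` iff it is a norm `c̄y · y`), and any `ξ`: at every finite place `v ∉ ramOfRecord₂ ξ` the local FORM SIGN
`formSignAt L c H v` (the norm class of `−det H` in `L⁺_vˣ ∕ N L_wˣ`, ★ `LocalHermitianFormSign`) is `+1`.

THE PROOF (print's «`c_v = 1` for almost all `v`», made exact at the record's exceptional set; road of LH7-typ2 ∕ AUDIT S7#6 (a), all tools ★).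
* SPLIT `v` (two places above `v`): ★ `formSignAt_of_not_subsingleton` — every unit is a norm from `L_v ≅ L⁺_v × L⁺_v`.
* NON-SPLIT `v`: every `w ∣ v` is `c`-fixed (`formSignOffRam_smul_eq_of_subsingleton`).  Off `ramOfRecord₂ ξ` the place is GOOD (★ `good_of_not_mem_ramOfRecord₂`):
  `μω` is unramified at every `w ∣ v` and `H_w ∈ GL₃(𝒪_w)`, so `det H` is a `w`-adic unit (`formSignOffRam_valued_det_eq_one`, via ★ `valuation_det_eq_one_of_mem_glInt`
  and the `Valued`∕`ValuativeRel` bridge ★ `v_eq_one_iff_valuation_eq_one`); hence the unit `u := (−det H) ⊗ 1` of `L ⊗ L⁺_v = ∏_{w ∣ v} L_w` has valuation-`1`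
  components and (B1) ★ `semilocalComponent_eq_one_of_forall_isUnramifiedAt` gives `μω_v(u) = 1`.  `u` is `(c ⊗ 1)`-fixed (★ `conjLocal_algebraMap`; `−det H ∈ L⁺`
  for hermitian `H`, ★ `neg_det_mem_maximalRealSubfield_of_isHermitian` + Mathlib `IsCMField.complexConj_eq_self_iff`), so `hquad` yields a unit `y` with
  `c̄y · y = u`, and ★ `formSignAt_of_subsingleton` evaluates the sign to `+1` on the witness `z := y`.
No Hilbert-symbol detour (AUDIT S7#6 (a)); the `hquad`-step is the content.

HONEST LABEL: a kit-free socket closes no citation.  HC_CM is proved only modulo the 7 printed citations (2 remaining named inputs: hLiu418 =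
stmt-HodgeConjecture-24832, h413 = stmt-HodgeConjecture-24833) — until rung 0 closes.

## References
* [Rogawski1990] J. D. Rogawski, *Automorphic Representations of Unitary Groups in Three Variables*, Ann. of Math. Stud. 123 (1990), §14.6 p. 242
  («`Δ′_v = c_v Δ″_v`, `c_v = 1` for almost all `v`»), (14.6.3) p. 243; §3.5 Prop. 3.5.2 (c) p. 29; §12.2 pp. 173–174; §4.8 p. 51 (`μ|F* = ω_{E/F}`).
* [Omeara1963] O. T. O'Meara, *Introduction to Quadratic Forms* (1963), §63B (units are norms from the unramified quadratic extension).
* [PlatonovRapinchuk1994] V. Platonov, A. Rapinchuk, *Algebraic Groups and Number Theory* (1994), §5.1 (`G_{𝒪_v}` for almost all `v`).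
* [TateThesis1967] J. Tate, *Fourier analysis in number fields and Hecke's zeta-functions* (1967), §4.3 (local components of a Hecke character).
-/

set_option autoImplicit false
-- the mandated namespace repeats the single-problem summit's segment (`HodgeConjecture.HodgeConjecture`)
set_option linter.dupNamespace false

noncomputable section

open NumberField IsDedekindDomain MeasureTheory
open scoped Matrix MatrixGroups

namespace Summit.HodgeConjecture.HodgeConjecture.R90.S7

open Literature.NumberTheory Literature.NumberTheory.Automorphic Literature.NumberTheory.Automorphic.UnitaryGroup
open Literature.NumberTheory.Rogawski1990 Literature.NumberTheory.GaloisRepresentations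
open Summit.HodgeConjecture.HodgeConjecture.Cruxes.H413
open Summit.HodgeConjecture.HodgeConjecture.Cruxes.H413.F0P3XiLocalFamilyOfRecord
open Summit.HodgeConjecture.HodgeConjecture.Cruxes.H413.F0P3XiPacketFamilyOfRecord (ramOfRecord₂ good_of_not_mem_ramOfRecord₂)

/-! ## §1 Two local helpers -/

/-- **At a NON-SPLIT place every place above `v` is `c`-fixed**: if `PlacesOver L v` is a subsingleton then `c • w = w` for `w ∣ v`
(`c⁻¹ • w` lies over `v` too, ★ `PlacesOver.galInv`). [cite: Rogawski1990, §12.2 p. 173] -/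
theorem formSignOffRam_smul_eq_of_subsingleton (L : Type) [Field L] [NumberField L] [IsCMField L]
    {v : HeightOneSpectrum (𝓞 ↥(maximalRealSubfield L))} (hsub : Subsingleton (PlacesOver L v)) (w : PlacesOver L v) :
    IsCMField.complexConj L • w.1 = w.1 := by
  have h : (IsCMField.complexConj L)⁻¹ • w.1 = w.1 :=
    congrArg Subtype.val (Subsingleton.elim (PlacesOver.galInv (IsCMField.complexConj L) w) w)
  calc IsCMField.complexConj L • w.1 = IsCMField.complexConj L • ((IsCMField.complexConj L)⁻¹ • w.1) := by rw [h]
    _ = w.1 := smul_inv_smul _ _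

/-- **`H_w ∈ GL₃(𝒪_w)` ⇒ `det H` is a `w`-adic unit**: if the unit `H ⊗ 1 ∈ GL₃(L_w)` lies in `GL₃(𝒪_w)` (`glInt`), then `v_w(det H) = 1`
(★ `valuation_det_eq_one_of_mem_glInt`, read in the `Valued` currency through ★ `v_eq_one_iff_valuation_eq_one`). [cite: PlatonovRapinchuk1994, §5.1] -/
theorem formSignOffRam_valued_det_eq_one (L : Type) [Field L] [NumberField L] (H : Matrix (Fin 3) (Fin 3) L) (hHd : IsUnit H.det)
    (w : HeightOneSpectrum (𝓞 L)) (hw : (isUnit_placeForm_of_isUnit_det hHd w).unit ∈ glInt 3 (w.adicCompletion L)) :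
    Valued.v (algebraMap L (w.adicCompletion L) H.det) = 1 := by
  have hdet : (placeForm H w).det = algebraMap L (w.adicCompletion L) H.det := by
    rw [RingHom.map_det, RingHom.mapMatrix_apply]
  have h := valuation_det_eq_one_of_mem_glInt hw
  rw [IsUnit.unit_spec, hdet] at h
  exact (v_eq_one_iff_valuation_eq_one _).2 h

/-! ## §2 The socket S7#6, proved -/

/-- **SOCKET S7#6 `stub_R90_S7_formSignOffRam` PROVED — «`c_v = 1` off `ramOfRecord₂ ξ`»** ([Rogawski1990, §14.6 p. 242 «`c_v = 1` for almost all `v`», made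
exact at the record's exceptional set).  For the hermitian `H` of the frame (`IsUnit H.det`), the CM Hecke character `μω` with the frame hypothesis `hquad`, and any
`ξ`, every finite place `v ∉ ramOfRecord₂ ξ` has local form sign `formSignAt L c H v = 1`.  Split `v`: ★ `formSignAt_of_not_subsingleton`.  Non-split `v`:
★ `good_of_not_mem_ramOfRecord₂` gives `μω` unramified above `v` and `H_w ∈ GL₃(𝒪_w)`, so `u = (−det H) ⊗ 1` is a `(c ⊗ 1)`-fixed unit with valuation-`1` components,
`μω_v(u) = 1` by (B1) ★ `semilocalComponent_eq_one_of_forall_isUnramifiedAt`, and `hquad` makes `u` a norm `c̄y · y`: the witness for ★ `formSignAt_of_subsingleton`.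
Binders token-for-token those of the socket (`Cruxes/H413/Lines/R90_S7_PKtupleBaseChainA.lean`).
[cite: Rogawski1990, §14.6 p. 242; (14.6.3) p. 243; §3.5 Prop. 3.5.2 (c) p. 29; §4.8 p. 51] [cite: Omeara1963, §63B] -/
theorem formSignOffRam
    (L : Type) [Field L] [NumberField L] [IsCMField L] (H : Matrix (Fin 3) (Fin 3) L)
    (hH : (H.map (cmConjRingHom L))ᵀ = H) (hHd : IsUnit H.det) (μω : HeckeCharacter L)
    [∀ v : HeightOneSpectrum (𝓞 ↥(maximalRealSubfield L)), MeasurableSpace (Gqs L v ⧸ Subgroup.center (Gqs L v))]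
    (μZ : ∀ v : HeightOneSpectrum (𝓞 ↥(maximalRealSubfield L)), Measure (Gqs L v ⧸ Subgroup.center (Gqs L v)))
    (keys : ∀ (ξ : OneDimAutRepH L) (v : HeightOneSpectrum (𝓞 ↥(maximalRealSubfield L))),
      (∀ w : PlacesOver L v, IsCMField.complexConj L • w.1 = w.1) →
        {p : IrrClass (Gqs L v) × IrrClass (Gqs L v) //
          KeysCaseTwoLabels L v (μω.semilocalComponent L v) (torusLocalComponent L (IsCMField.complexConj L) v ξ.η)
            (torusLocalComponent L (IsCMField.complexConj L) v ξ.ψ) p.1 p.2 ∧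
          p.1.IsSquareIntegrable (μZ v) ∧ ¬ p.2.IsSquareIntegrable (μZ v)})
    (hquad : ∀ v : HeightOneSpectrum (𝓞 ↥(maximalRealSubfield L)), (∀ w : PlacesOver L v, IsCMField.complexConj L • w.1 = w.1) →
      IsQuadraticCharExtension (conjLocal L (IsCMField.complexConj L) v) (μω.semilocalComponent L v))
    (ξ : OneDimAutRepH L)
    (hexc : ∀ᶠ v : HeightOneSpectrum (𝓞 ↥(maximalRealSubfield L)) in Filter.cofinite,
      ∀ hns : ∀ w : PlacesOver L v, IsCMField.complexConj L • w.1 = w.1,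
        ((keys ξ v hns).1.2).IsSpherical (cmLocalIntegralLevel L 3 (qsForm L) v))
    (v : HeightOneSpectrum (𝓞 ↥(maximalRealSubfield L)))
    (hv : v ∉ ramOfRecord₂ L H hH hHd μω μZ keys ξ hexc) :
    formSignAt L (IsCMField.complexConj L) H v = 1 := by
  by_cases hsplit : Subsingleton (PlacesOver L v)
  swap
  · -- SPLIT place: every unit is a norm
    exact formSignAt_of_not_subsingleton L (IsCMField.complexConj L) H v hsplit
  -- NON-SPLIT place: every `w ∣ v` is `c`-fixed and `v` is good for the record
  have hns : ∀ w : PlacesOver L v, IsCMField.complexConj L • w.1 = w.1 :=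
    fun w => formSignOffRam_smul_eq_of_subsingleton L hsplit w
  obtain ⟨hgood, -⟩ := good_of_not_mem_ramOfRecord₂ L H hH hHd μω μZ keys ξ hv
  -- the unit `u := (−det H) ⊗ 1` of `L ⊗ L⁺_v = ∏_{w ∣ v} L_w`
  have hdU : IsUnit (algebraMap L (LocalRing L v) (-H.det)) := hHd.neg.map (algebraMap L (LocalRing L v))
  have hu_val : ((hdU.unit : (LocalRing L v)ˣ) : LocalRing L v) = algebraMap L (LocalRing L v) (-H.det) := hdU.unit_spec
  -- its components have valuation `1` (`H_w ∈ GL₃(𝒪_w)` at the good place)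
  have hval : ∀ w : PlacesOver L v, Valued.v (((hdU.unit : (LocalRing L v)ˣ) : LocalRing L v) w) = 1 := by
    intro w
    rw [hu_val, Pi.algebraMap_apply, map_neg, Valuation.map_neg]
    exact formSignOffRam_valued_det_eq_one L H hHd w.1 (hgood w).2.2.2
  -- (B1): `μω_v(u) = 1` since `μω` is unramified at every `w ∣ v`
  have hμ : μω.semilocalComponent L v hdU.unit = 1 :=
    semilocalComponent_eq_one_of_forall_isUnramifiedAt L v μω (fun w => (hgood w).2.2.1) hdU.unit hval
  -- `u` is `(c ⊗ 1)`-fixed: `−det H ∈ L⁺` for hermitian `H`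
  have hfix : conjLocal L (IsCMField.complexConj L) v ((hdU.unit : (LocalRing L v)ˣ) : LocalRing L v) = hdU.unit := by
    rw [hu_val, conjLocal_algebraMap,
      (IsCMField.complexConj_eq_self_iff L (-H.det)).2 (neg_det_mem_maximalRealSubfield_of_isHermitian L hH)]
  -- `hquad`: a `c`-fixed unit killed by `μω_v` is a norm `c̄y · y`
  obtain ⟨y, hy⟩ := (hquad v hns hdU.unit hfix).1 hμ
  have key : ∃ z : LocalRing L v, IsUnit z ∧
      algebraMap L (LocalRing L v) (-H.det) = z * conjLocal L (IsCMField.complexConj L) v z :=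
    ⟨(y : LocalRing L v), y.isUnit, by rw [← hu_val, ← hy, mul_comm]⟩
  rw [formSignAt_of_subsingleton L (IsCMField.complexConj L) H v hsplit, if_pos key]

end Summit.HodgeConjecture.HodgeConjecture.R90.S7

end
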